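import Mathlib
import HarnessLib

/-!
# A smooth step function with Gevrey-2 derivative bounds

Stub file for crux `stmt-QuantumFields-16154` (`HypercubicLimit`), line `Sketch` (coupling response), Z1-explicit
piece E1 (`exists_gevreyStep`): a `C^∞` function `g : ℝ → ℝ` with `g = 0` on `(-∞, 0]`, `g = 1` on `[1, ∞)`,
values in `[0, 1]`, and the Gevrey-2 bounds `‖g^{(l)}‖ ≤ Cg ^ (l + 1) * (l!)²` with an explicit constant
(`Cg = 48 + Z⁻¹`, `Z` the mass of the bump below).  This is the one-dimensional building block of the smooth
cutoffs near the coincidence locus with explicit factorial bookkeeping (linear growth condition E0′).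

Construction: `f := expNegInvGlue` (Mathlib), the bump `b x := f x * f (1 - x)` and `g x := (∫₀ˣ b) / ∫₀¹ b`.
The derivative bounds for `f` are obtained on the real line: Mathlib's
`expNegInvGlue.hasDerivAt_polynomial_eval_inv_mul` gives `f^{(n)}(x) = Pₙ(x⁻¹) f(x)` with `P₀ = 1`,
`Pₙ₊₁ = X² (Pₙ - Pₙ')`; the weighted coefficient bound `|coeff Pₙ k| · k! ≤ 8ⁿ (n!)²` (induction on `n`, using
`deg Pₙ ≤ 2n`) and `yᵏ e^{-y} ≤ k!` give `|f^{(n)}| ≤ 24ⁿ (n!)²`; the Leibniz rule gives `48ⁿ (n!)²` for the bump,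
and the fundamental theorem of calculus transfers the bounds to `g`.  No complex analysis is used.
-/

noncomputable section

open scoped ContDiff
open Polynomial MeasureTheory Set

namespace Summit.QuantumFields.YangMills.Cruxes.HypercubicLimit.CouplingResponse

/-- The iterated derivatives of `expNegInvGlue`: `f^{(n)}(x) = Pₙ(x⁻¹) · f(x)` on all of `ℝ`, where
`Pₙ = T^[n] 1` for the operator `T p = X² (p - p')` on `ℝ[X]` (iterate Mathlib's
`expNegInvGlue.hasDerivAt_polynomial_eval_inv_mul`). [folklore] -/
theorem iteratedDeriv_expNegInvGlue_eq (n : ℕ) :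
    iteratedDeriv n expNegInvGlue = fun x =>
      ((fun p : ℝ[X] => X ^ 2 * (p - derivative p))^[n] 1).eval x⁻¹ * expNegInvGlue x := by
  induction n with
  | zero => funext x; simp
  | succ n ih =>
    rw [iteratedDeriv_succ, ih, Function.iterate_succ_apply']
    funext x
    exact (expNegInvGlue.hasDerivAt_polynomial_eval_inv_mul _ x).deriv

/-- Degree bound `deg Pₙ ≤ 2n` for `Pₙ = T^[n] 1`, `T p = X² (p - p')`. [folklore] -/
theorem natDegree_iterate_gevreyOp_le (n : ℕ) :
    ((fun p : ℝ[X] => X ^ 2 * (p - derivative p))^[n] 1).natDegree ≤ 2 * n := by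
  induction n with
  | zero => simp
  | succ n ih =>
    rw [Function.iterate_succ_apply']
    set p := (fun p : ℝ[X] => X ^ 2 * (p - derivative p))^[n] 1
    have h1 : (X ^ 2 : ℝ[X]).natDegree ≤ 2 := natDegree_X_pow_le 2
    have h2 : (p - derivative p).natDegree ≤ 2 * n :=
      (natDegree_sub_le _ _).trans
        (max_le ih ((natDegree_derivative_le _).trans ((Nat.sub_le _ _).trans ih)))
    exact natDegree_mul_le.trans (by omega)

/-- Weighted coefficient bound `|coeff Pₙ k| · k! ≤ 8ⁿ (n!)²` for `Pₙ = T^[n] 1`, `T p = X² (p - p')`: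
from `coeff Pₙ₊₁ (k+2) = coeff Pₙ k - (k+1) · coeff Pₙ (k+1)`, `deg Pₙ ≤ 2n` and
`2 (2n+1) (2n+2) ≤ 8 (n+1)²`. [folklore] -/
theorem abs_coeff_iterate_gevreyOp_mul_factorial_le (n k : ℕ) :
    |((fun p : ℝ[X] => X ^ 2 * (p - derivative p))^[n] 1).coeff k| * (k.factorial : ℝ) ≤
      8 ^ n * (n.factorial : ℝ) ^ 2 := by
  induction n generalizing k with
  | zero =>
    rcases k with _ | k
    · simp
    · simp [Polynomial.coeff_one]
  | succ n ih =>
    rw [Function.iterate_succ_apply']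
    set p := (fun p : ℝ[X] => X ^ 2 * (p - derivative p))^[n] 1
    have hdeg : p.natDegree ≤ 2 * n := natDegree_iterate_gevreyOp_le n
    have hB : (0 : ℝ) ≤ 8 ^ n * (n.factorial : ℝ) ^ 2 := by positivity
    have hB' : (0 : ℝ) ≤ 8 ^ (n + 1) * ((n + 1).factorial : ℝ) ^ 2 := by positivity
    rcases k with _ | _ | j
    · simp
    · simp [coeff_X_pow_mul']
    · rw [coeff_X_pow_mul, coeff_sub, coeff_derivative]
      rcases lt_or_ge (2 * n) j with hj | hj
      · have h0 : p.coeff j = 0 := coeff_eq_zero_of_natDegree_lt (by omega)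
        have h1 : p.coeff (j + 1) = 0 := coeff_eq_zero_of_natDegree_lt (by omega)
        simp [h0, h1]
      · have h0 := ih j
        have h1 := ih (j + 1)
        have hjr : (j : ℝ) ≤ 2 * n := by exact_mod_cast hj
        have hn : (0 : ℝ) ≤ n := n.cast_nonneg
        have hfac : ((j + 2).factorial : ℝ) = (j + 2) * (j + 1) * j.factorial := by
          push_cast [Nat.factorial_succ]; ring
        have hfac1 : ((j + 1).factorial : ℝ) = (j + 1) * j.factorial := by
          push_cast [Nat.factorial_succ]; ring
        have hfacn : ((n + 1).factorial : ℝ) = (n + 1) * n.factorial := by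
          push_cast [Nat.factorial_succ]; ring
        have habs : |p.coeff j - p.coeff (j + 1) * ((j : ℝ) + 1)| ≤
            |p.coeff j| + |p.coeff (j + 1)| * ((j : ℝ) + 1) := by
          refine (abs_sub _ _).trans ?_
          rw [abs_mul, abs_of_nonneg (by positivity : (0 : ℝ) ≤ (j : ℝ) + 1)]
        calc |p.coeff j - p.coeff (j + 1) * ((j : ℝ) + 1)| * ((j + 2).factorial : ℝ)
            ≤ (|p.coeff j| + |p.coeff (j + 1)| * ((j : ℝ) + 1)) * ((j + 2).factorial : ℝ) := by
              gcongr
          _ = ((j : ℝ) + 1) * ((j : ℝ) + 2) * (|p.coeff j| * (j.factorial : ℝ))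
              + ((j : ℝ) + 1) * ((j : ℝ) + 2) * (|p.coeff (j + 1)| * ((j + 1).factorial : ℝ)) := by
              rw [hfac, hfac1]; ring
          _ ≤ (2 * (n : ℝ) + 1) * (2 * (n : ℝ) + 2) * (8 ^ n * (n.factorial : ℝ) ^ 2)
              + (2 * (n : ℝ) + 1) * (2 * (n : ℝ) + 2) * (8 ^ n * (n.factorial : ℝ) ^ 2) := by
              gcongr
          _ = (2 * (2 * (n : ℝ) + 1) * (2 * (n : ℝ) + 2)) * (8 ^ n * (n.factorial : ℝ) ^ 2) := by ring
          _ ≤ (8 * ((n : ℝ) + 1) ^ 2) * (8 ^ n * (n.factorial : ℝ) ^ 2) :=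
              mul_le_mul_of_nonneg_right (by nlinarith [hn]) hB
          _ = 8 ^ (n + 1) * ((n + 1).factorial : ℝ) ^ 2 := by rw [hfacn]; ring

/-- For a real polynomial `p` with `deg p < N`: `|p(x⁻¹) · expNegInvGlue x| ≤ Σ_{k<N} |coeff p k| · k!`, from
`yᵏ e^{-y} ≤ k!` (`Real.pow_div_factorial_le_exp`). [folklore] -/
theorem abs_eval_inv_mul_expNegInvGlue_le (p : ℝ[X]) {N : ℕ} (hN : p.natDegree < N) (x : ℝ) :
    |p.eval x⁻¹ * expNegInvGlue x| ≤ ∑ k ∈ Finset.range N, |p.coeff k| * (k.factorial : ℝ) := by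
  rcases le_or_gt x 0 with hx | hx
  · rw [expNegInvGlue.zero_of_nonpos hx, mul_zero, abs_zero]
    exact Finset.sum_nonneg fun k _ => by positivity
  have hy : 0 < x⁻¹ := inv_pos.2 hx
  have hexp : expNegInvGlue x = Real.exp (-x⁻¹) := by simp [expNegInvGlue, not_le.2 hx]
  rw [hexp, eval_eq_sum_range' hN, abs_mul, abs_of_pos (Real.exp_pos _)]
  calc |∑ k ∈ Finset.range N, p.coeff k * x⁻¹ ^ k| * Real.exp (-x⁻¹)
      ≤ (∑ k ∈ Finset.range N, |p.coeff k * x⁻¹ ^ k|) * Real.exp (-x⁻¹) := by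
        gcongr; exact Finset.abs_sum_le_sum_abs _ _
    _ = ∑ k ∈ Finset.range N, |p.coeff k| * (x⁻¹ ^ k * Real.exp (-x⁻¹)) := by
        rw [Finset.sum_mul]
        refine Finset.sum_congr rfl fun k _ => ?_
        rw [abs_mul, abs_of_nonneg (pow_nonneg hy.le _)]; ring
    _ ≤ ∑ k ∈ Finset.range N, |p.coeff k| * (k.factorial : ℝ) := by
        gcongr with k _
        have h := Real.pow_div_factorial_le_exp x⁻¹ hy.le k
        rw [div_le_iff₀ (by positivity)] at h
        rw [Real.exp_neg, ← div_eq_mul_inv, div_le_iff₀ (Real.exp_pos _)]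
        linarith

/-- **Gevrey-2 bound for `expNegInvGlue`**: `‖f^{(n)}(x)‖ ≤ 24ⁿ (n!)²` for all `n` and `x`. [folklore] -/
theorem norm_iteratedDeriv_expNegInvGlue_le (n : ℕ) (x : ℝ) :
    ‖iteratedDeriv n expNegInvGlue x‖ ≤ 24 ^ n * (n.factorial : ℝ) ^ 2 := by
  rw [iteratedDeriv_expNegInvGlue_eq n, Real.norm_eq_abs]
  have hN := Nat.lt_succ_of_le (natDegree_iterate_gevreyOp_le n)
  refine (abs_eval_inv_mul_expNegInvGlue_le _ hN x).trans ?_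
  have h3 : (2 * n + 1 : ℝ) ≤ 3 ^ n := by
    have := one_add_mul_le_pow (show (-2 : ℝ) ≤ 2 by norm_num) n
    norm_num at this
    linarith
  calc ∑ k ∈ Finset.range (2 * n + 1),
        |((fun p : ℝ[X] => X ^ 2 * (p - derivative p))^[n] 1).coeff k| * (k.factorial : ℝ)
      ≤ ∑ _k ∈ Finset.range (2 * n + 1), 8 ^ n * (n.factorial : ℝ) ^ 2 :=
        Finset.sum_le_sum fun k _ => abs_coeff_iterate_gevreyOp_mul_factorial_le n k
    _ = (2 * n + 1) * (8 ^ n * (n.factorial : ℝ) ^ 2) := by simp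
    _ ≤ 3 ^ n * (8 ^ n * (n.factorial : ℝ) ^ 2) := by gcongr
    _ = 24 ^ n * (n.factorial : ℝ) ^ 2 := by
        rw [show (24 : ℝ) = 3 * 8 by norm_num, mul_pow]; ring

/-- **Gevrey-2 bound for the bump** `b x = f x · f (1 - x)`, `f = expNegInvGlue`: `‖b^{(n)}(x)‖ ≤ 48ⁿ (n!)²`
(Leibniz rule `iteratedDeriv_mul` and `C(n,i) (i!)² ((n-i)!)² ≤ (n!)²`). [folklore] -/
theorem norm_iteratedDeriv_bump_le (n : ℕ) (x : ℝ) :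
    ‖iteratedDeriv n (fun y => expNegInvGlue y * expNegInvGlue (1 - y)) x‖ ≤
      48 ^ n * (n.factorial : ℝ) ^ 2 := by
  have hf : ContDiff ℝ n expNegInvGlue := expNegInvGlue.contDiff
  have hg : ContDiff ℝ n (fun y => expNegInvGlue (1 - y)) :=
    expNegInvGlue.contDiff.comp (contDiff_const.sub contDiff_id)
  rw [iteratedDeriv_fun_mul hf.contDiffAt hg.contDiffAt]
  have h2 : ((n : ℝ) + 1) ≤ 2 ^ n := by exact_mod_cast Nat.succ_le_of_lt Nat.lt_two_pow_self
  calc ‖∑ i ∈ Finset.range (n + 1), (n.choose i : ℝ) * iteratedDeriv i expNegInvGlue x *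
          iteratedDeriv (n - i) (fun y => expNegInvGlue (1 - y)) x‖
      ≤ ∑ i ∈ Finset.range (n + 1), ‖(n.choose i : ℝ) * iteratedDeriv i expNegInvGlue x *
          iteratedDeriv (n - i) (fun y => expNegInvGlue (1 - y)) x‖ := norm_sum_le _ _
    _ ≤ ∑ i ∈ Finset.range (n + 1), (n.choose i : ℝ) * (24 ^ i * (i.factorial : ℝ) ^ 2) *
          (24 ^ (n - i) * ((n - i).factorial : ℝ) ^ 2) := by
        gcongr with i hi
        have hcs : iteratedDeriv (n - i) (fun y => expNegInvGlue (1 - y)) x =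
            (-1 : ℝ) ^ (n - i) • iteratedDeriv (n - i) expNegInvGlue (1 - x) := by
          rw [iteratedDeriv_comp_const_sub]
        rw [norm_mul, norm_mul, Real.norm_natCast, hcs, norm_smul, norm_pow, norm_neg, norm_one, one_pow,
          one_mul]
        gcongr
        · exact norm_iteratedDeriv_expNegInvGlue_le i x
        · exact norm_iteratedDeriv_expNegInvGlue_le (n - i) (1 - x)
    _ = 24 ^ n * ∑ i ∈ Finset.range (n + 1),
          ((n.choose i * i.factorial * (n - i).factorial : ℕ) : ℝ) *
            ((i.factorial * (n - i).factorial : ℕ) : ℝ) := by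
        rw [Finset.mul_sum]
        refine Finset.sum_congr rfl fun i hi => ?_
        have hi' : i ≤ n := Nat.lt_succ_iff.mp (Finset.mem_range.mp hi)
        rw [← pow_mul_pow_sub (24 : ℝ) hi']
        push_cast
        ring
    _ ≤ 24 ^ n * ∑ _i ∈ Finset.range (n + 1), (n.factorial : ℝ) ^ 2 := by
        gcongr with i hi
        have hi' : i ≤ n := Nat.lt_succ_iff.mp (Finset.mem_range.mp hi)
        have hle : i.factorial * (n - i).factorial ≤ n.factorial := by
          have := Nat.factorial_mul_factorial_dvd_factorial_add i (n - i)
          rw [Nat.add_sub_cancel' hi'] at this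
          exact Nat.le_of_dvd (Nat.factorial_pos _) this
        rw [Nat.choose_mul_factorial_mul_factorial hi', sq]
        exact mul_le_mul_of_nonneg_left (by exact_mod_cast hle) (by positivity)
    _ = 24 ^ n * (((n : ℝ) + 1) * (n.factorial : ℝ) ^ 2) := by simp
    _ ≤ 24 ^ n * (2 ^ n * (n.factorial : ℝ) ^ 2) := by gcongr
    _ = 48 ^ n * (n.factorial : ℝ) ^ 2 := by
        rw [show (48 : ℝ) = 24 * 2 by norm_num, mul_pow]; ring

/-- **Registered stub `exists_gevreyStep`** (line `Sketch`, Z1-explicit E1): there is a `C^∞` step function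
`g : ℝ → ℝ`, `0 ≤ g ≤ 1`, `g = 0` on `(-∞, 0]`, `g = 1` on `[1, ∞)`, with the Gevrey-2 derivative bounds
`‖g^{(l)}(x)‖ ≤ Cg ^ (l + 1) (l!)²` for an explicit `Cg ≥ 1`.  Take `g = (∫₀ˣ b) / Z` with the bump
`b x = expNegInvGlue x · expNegInvGlue (1 - x)`, `Z = ∫₀¹ b > 0` and `Cg = 48 + Z⁻¹`
(`norm_iteratedDeriv_bump_le` and the fundamental theorem of calculus). [folklore] -/
theorem exists_gevreyStep : ∃ (g : ℝ → ℝ) (Cg : ℝ), 1 ≤ Cg ∧ ContDiff ℝ ∞ g ∧ (∀ x, 0 ≤ g x ∧ g x ≤ 1) ∧ (∀ x ≤ 0, g x = 0) ∧ (∀ x, 1 ≤ x → g x = 1) ∧ ∀ (l : ℕ) (x : ℝ), ‖iteratedDeriv l g x‖ ≤ Cg ^ (l + 1) * ((l.factorial : ℝ)) ^ 2 := by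
  set b : ℝ → ℝ := fun y => expNegInvGlue y * expNegInvGlue (1 - y) with hb
  have hb_smooth : ContDiff ℝ ∞ b :=
    expNegInvGlue.contDiff.mul (expNegInvGlue.contDiff.comp (contDiff_const.sub contDiff_id))
  have hb_cont : Continuous b := hb_smooth.continuous
  have hb_nonneg : ∀ y, 0 ≤ b y := fun y => mul_nonneg (expNegInvGlue.nonneg _) (expNegInvGlue.nonneg _)
  have hint : ∀ a c : ℝ, IntervalIntegrable b volume a c := fun a c => hb_cont.intervalIntegrable a c
  set Z : ℝ := ∫ t in (0 : ℝ)..1, b t with hZdef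
  have hZ : 0 < Z :=
    intervalIntegral.intervalIntegral_pos_of_pos_on (hint 0 1)
      (fun t ht => mul_pos (expNegInvGlue.pos_of_pos ht.1) (expNegInvGlue.pos_of_pos (by linarith [ht.2])))
      one_pos
  set G : ℝ → ℝ := fun y => ∫ t in (0 : ℝ)..y, b t with hGdef
  have hG_deriv : deriv G = b := funext fun y => hb_cont.deriv_integral b 0 y
  have hG_diff : Differentiable ℝ G := fun y => (hb_cont.integral_hasStrictDerivAt 0 y).hasDerivAt.differentiableAt
  have hG_smooth : ContDiff ℝ ∞ G := contDiff_infty_iff_deriv.2 ⟨hG_diff, hG_deriv ▸ hb_smooth⟩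
  have hG0 : ∀ y ≤ 0, G y = 0 := fun y hy => by
    have h : EqOn b (fun _ => (0 : ℝ)) (uIcc 0 y) := fun t ht => by
      rw [uIcc_of_ge hy] at ht
      show expNegInvGlue t * expNegInvGlue (1 - t) = 0
      rw [expNegInvGlue.zero_of_nonpos ht.2, zero_mul]
    show (∫ t in (0 : ℝ)..y, b t) = 0
    rw [intervalIntegral.integral_congr h, intervalIntegral.integral_zero]
  have hG1 : ∀ y, 1 ≤ y → G y = Z := fun y hy => by
    have h : EqOn b (fun _ => (0 : ℝ)) (uIcc 1 y) := fun t ht => by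
      rw [uIcc_of_le hy] at ht
      show expNegInvGlue t * expNegInvGlue (1 - t) = 0
      rw [expNegInvGlue.zero_of_nonpos (x := 1 - t) (by linarith [ht.1]), mul_zero]
    show (∫ t in (0 : ℝ)..y, b t) = ∫ t in (0 : ℝ)..1, b t
    rw [← intervalIntegral.integral_add_adjacent_intervals (hint 0 1) (hint 1 y),
      intervalIntegral.integral_congr h, intervalIntegral.integral_zero, add_zero]
  have hmono : Monotone G :=
    monotone_of_deriv_nonneg hG_diff fun y => by rw [hG_deriv]; exact hb_nonneg y
  have hG_nonneg : ∀ y, 0 ≤ G y := fun y => by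
    rcases le_or_gt y 0 with hy | hy
    · rw [hG0 y hy]
    · simpa [hG0 0 le_rfl] using hmono hy.le
  have hG_le : ∀ y, G y ≤ Z := fun y => by
    rcases le_or_gt 1 y with hy | hy
    · rw [hG1 y hy]
    · simpa [hG1 1 le_rfl] using hmono hy.le
  have hCg : (48 : ℝ) ≤ 48 + Z⁻¹ := by have := inv_pos.2 hZ; linarith
  refine ⟨fun y => G y / Z, 48 + Z⁻¹, by linarith, hG_smooth.div_const Z,
    fun y => ⟨div_nonneg (hG_nonneg y) hZ.le, div_le_one_of_le₀ (hG_le y) hZ.le⟩,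
    fun y hy => by simp [hG0 y hy], fun y hy => by simp [hG1 y hy, hZ.ne'], ?_⟩
  intro l y
  rw [iteratedDeriv_div_const]
  rcases l with _ | k
  · rw [iteratedDeriv_zero, norm_div, Real.norm_of_nonneg (hG_nonneg y), Real.norm_of_nonneg hZ.le]
    have : G y / Z ≤ 1 := div_le_one_of_le₀ (hG_le y) hZ.le
    simp only [zero_add, pow_one, Nat.factorial_zero, Nat.cast_one, one_pow, mul_one]
    linarith
  · rw [iteratedDeriv_succ', hG_deriv, norm_div, Real.norm_of_nonneg hZ.le, div_le_iff₀ hZ]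
    have hbk : ‖iteratedDeriv k b y‖ ≤ 48 ^ k * (k.factorial : ℝ) ^ 2 := norm_iteratedDeriv_bump_le k y
    have hCgZ : 1 ≤ (48 + Z⁻¹) * Z := by
      rw [add_mul, inv_mul_cancel₀ hZ.ne']; nlinarith
    have hfk : (k.factorial : ℝ) ≤ (k + 1).factorial := by
      exact_mod_cast Nat.factorial_le (Nat.le_succ k)
    calc ‖iteratedDeriv k b y‖ ≤ 48 ^ k * (k.factorial : ℝ) ^ 2 := hbk
      _ ≤ (48 + Z⁻¹) ^ k * ((k + 1).factorial : ℝ) ^ 2 := by gcongr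
      _ = (48 + Z⁻¹) ^ k * ((k + 1).factorial : ℝ) ^ 2 * 1 * 1 := by ring
      _ ≤ (48 + Z⁻¹) ^ k * ((k + 1).factorial : ℝ) ^ 2 * (48 + Z⁻¹) * ((48 + Z⁻¹) * Z) := by
          gcongr; linarith
      _ = (48 + Z⁻¹) ^ (k + 1 + 1) * ((k + 1).factorial : ℝ) ^ 2 * Z := by ring

end Summit.QuantumFields.YangMills.Cruxes.HypercubicLimit.CouplingResponse

end
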